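import Literature.Probability.Percolation.CardyFormula
import Literature.Probability.Percolation.QuadCrossingSquareModel
import Literature.Probability.RandomPlanarGeometry.CrossRatioContinuity
import Summits.CriticalPhenomena.CardyFormulaZ2.Theorems.RectilinearCardy.Negative.RectilinearCardyReductions

/-!
# Square models of a conformal rectangle: transfer of the crossing limit, dog-on-leash tools

Support file for `RectilinearSuffices` (route CardyBoundaryCoulombGas of `CardyFormulaZ2`,
item stmt-CriticalPhenomena-5663).

* `hasCrossingLimit_iff_of_eq` — the statement `R.HasCrossingLimit (bondDomainCrossingProb R) F`
  depends on `R` only through its carrier, its marked points and its arcs `0`, `2`; so it can be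
  transferred between two presentations of the same quad.
* `exists_isSquareModel_pt` — every conformal rectangle `R` has a square model `Φ : ℂ ≃ₜ ℂ`
  (tree: `exists_isSquareModel`, Schoenflies) which moreover sends the corners of the model
  square to the marked points; hence `R` has the same crossing-limit statement as the
  re-parametrised quad `unitSquareQuad.map Φ` (`hasCrossingLimit_iff_map_unitSquareQuad`).
* Dog-on-leash for closures (`not_mem_closure_of_dist_boundary_lt`,
  `mem_closure_or_infDist_le`): a point outside `closure D` farther from `∂D` than
  the leash is outside `closure D'` (index `0` is stable), complementing the tree's interior
  version `JordanDomain.mem_carrier_of_dist_boundary_lt`.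
* `exists_forall_dist_symm_le` — uniform continuity of `Φ⁻¹` near a compact set, in
  the form used to read `ε`-perturbations of `Φ`-images back in the model square.
-/

noncomputable section

namespace Summit.CriticalPhenomena.CardyFormulaZ2.Theorems

open Set Metric Filter Topology
open Literature.Probability.RandomPlanarGeometry Literature.Probability.Percolation

/-! ### Transfer of the crossing-limit statement between presentations of the same quad -/

/-- `R.HasCrossingLimit (bondDomainCrossingProb R) F` only depends on the carrier, the marked
points and the arcs `0` and `2` of `R`. [folklore] -/
theorem hasCrossingLimit_iff_of_eq (R S : ConformalRectangle) (hc : S.carrier = R.carrier)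
    (hpt : ∀ i, S.pt i = R.pt i) (h0 : S.arc 0 = R.arc 0) (h2 : S.arc 2 = R.arc 2) (F : ℝ → ℝ) :
    S.HasCrossingLimit (bondDomainCrossingProb S) F ↔
      R.HasCrossingLimit (bondDomainCrossingProb R) F := by
  have hp : bondDomainCrossingProb S = bondDomainCrossingProb R := by
    funext δ
    show discreteCrossingProb half S.carrier δ (S.arc 0) (S.arc 2) =
      discreteCrossingProb half R.carrier δ (R.arc 0) (R.arc 2)
    rw [hc, h0, h2]
  rw [hp]
  obtain ⟨⟨c, b, ho, hb, hconn, hcont, hper, hinj, hrange⟩, m, hm, hmem⟩ := S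
  change c = R.carrier at hc
  subst hc
  simp only [ConformalRectangle.HasCrossingLimit, MarkedDomain.IsUniformizing, hpt]

/-- **A square model respecting the corners.** Every conformal rectangle `R` admits a
homeomorphism `Φ` of `ℂ` mapping the model square `(-1,1)²` onto `R.carrier`, its `k`-th side onto
`R.arc k` and its `k`-th corner to `R.pt k` (the Schoenflies extension of the tree's boundary
correspondence `SquareModel.bdryMap`, which attributes the parameter `R.mark k` to corner `k`).
[folklore] -/
theorem exists_isSquareModel_pt (R : ConformalRectangle) :
    ∃ Φ : ℂ ≃ₜ ℂ, IsSquareModel R Φ ∧ ∀ k : Fin 4, Φ (unitSquareQuad.pt k) = R.pt k := by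
  obtain ⟨Φ, hΦ, hcar, -, -⟩ := unitSquareQuad.toJordanDomain.exists_homeomorph_eqOn_frontier
    R.toJordanDomain (SquareModel.continuousOn_bdryMap R) (SquareModel.bijOn_bdryMap R)
  refine ⟨Φ, ⟨hcar, fun k => ?_⟩, fun k => ?_⟩
  · rw [(hΦ.mono (unitSquareQuad.arc_subset_frontier k)).image_eq]
    exact SquareModel.image_bdryMap_arc R k
  · rw [hΦ (unitSquareQuad.pt_mem_frontier k)]
    obtain ⟨e0, e1, e2, e3⟩ := RectilinearCardy.Negative.rectQuad_pt (x₀ := -1) (x₁ := 1)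
      (y₀ := -1) (y₁ := 1) (by norm_num) (by norm_num)
    show R.boundary (SquareModel.param R (unitSquareQuad.pt k)) = R.boundary (R.mark k)
    congr 1
    fin_cases k
    · change SquareModel.param R (unitSquareQuad.pt 0) = R.mark 0
      rw [show unitSquareQuad.pt 0 = ⟨-1, -1⟩ from e0]
      simp [SquareModel.param]
    · change SquareModel.param R (unitSquareQuad.pt 1) = R.mark 1
      rw [show unitSquareQuad.pt 1 = ⟨1, -1⟩ from e1]
      simp [SquareModel.param]
    · change SquareModel.param R (unitSquareQuad.pt 2) = R.mark 2
      rw [show unitSquareQuad.pt 2 = ⟨1, 1⟩ from e2]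
      norm_num [SquareModel.param]
    · change SquareModel.param R (unitSquareQuad.pt 3) = R.mark 3
      rw [show unitSquareQuad.pt 3 = ⟨-1, 1⟩ from e3]
      norm_num [SquareModel.param]

/-- **Re-modelling a quad on the square.** For a square model `Φ` of `R` respecting the corners,
Cardy-type crossing-limit statements for `R` and for the quad `unitSquareQuad.map Φ` (same
carrier, arcs and marked points; boundary loop `Φ ∘ ∂(square)`) are equivalent. [folklore] -/
theorem hasCrossingLimit_iff_map_unitSquareQuad {R : ConformalRectangle} {Φ : ℂ ≃ₜ ℂ}
    (h : IsSquareModel R Φ) (hpt : ∀ k : Fin 4, Φ (unitSquareQuad.pt k) = R.pt k) (F : ℝ → ℝ) :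
    ConformalRectangle.HasCrossingLimit (unitSquareQuad.map Φ)
        (bondDomainCrossingProb (unitSquareQuad.map Φ)) F ↔
      R.HasCrossingLimit (bondDomainCrossingProb R) F :=
  hasCrossingLimit_iff_of_eq R _ (by rw [MarkedDomain.carrier_map, h.image_carrier])
    (fun i => by rw [MarkedDomain.pt_map, hpt]) (by rw [MarkedDomain.arc_map, h.image_arc])
    (by rw [MarkedDomain.arc_map, h.image_arc]) F

/-! ### Dog-on-leash for closures -/

/-- The index of `∂D'` about a point off `∂D` equals that of `∂D` when the loops are closer than
the distance from the point to `∂D` (Rouché for loops). [folklore] -/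
theorem index_eq_index_of_dist_boundary_lt_of_not_mem
    (D D' : JordanDomain) {z₀ : ℂ} (hz₀ : z₀ ∉ frontier D.carrier)
    (hclose : ∀ t, dist (D'.boundary t) (D.boundary t) < infDist z₀ (frontier D.carrier)) :
    D'.index z₀ = D.index z₀ := by
  have hD'1 : D'.boundary 0 = D'.boundary 1 := by
    have := D'.periodic_boundary 0; rw [zero_add] at this; exact this.symm
  have hD1 : D.boundary 0 = D.boundary 1 := by
    have := D.periodic_boundary 0; rw [zero_add] at this; exact this.symm
  refine Literature.Topology.PlaneTopology.wind_eq_of_norm_sub_lt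
    ((D'.continuous_boundary.sub continuous_const).continuousOn) (by rw [hD'1])
    ⟨(D.continuous_boundary.sub continuous_const).continuousOn, fun t _ ↦ ?_, by rw [hD1]⟩
    fun t _ ↦ ?_
  · exact sub_ne_zero.2 fun h0 ↦ hz₀ (by rw [← h0]; exact D.boundary_mem_frontier t)
  · rw [sub_sub_sub_cancel_right, ← dist_eq_norm, ← dist_eq_norm, dist_comm (D.boundary t) z₀]
    exact (hclose t).trans_le (infDist_le_dist_of_mem (D.boundary_mem_frontier t))

/-- **Dog-on-leash, exterior points**: a point outside `closure D` at distance from `∂D` larger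
than the leash between the two boundary loops lies outside `closure D'`. [folklore] -/
theorem not_mem_closure_of_dist_boundary_lt
    (D D' : JordanDomain) {z₀ : ℂ} (hz₀ : z₀ ∉ closure D.carrier)
    (hclose : ∀ t, dist (D'.boundary t) (D.boundary t) < infDist z₀ (frontier D.carrier)) :
    z₀ ∉ closure D'.carrier := by
  have hfr : z₀ ∉ frontier D.carrier := fun h => hz₀ (frontier_subset_closure h)
  have h0 : D'.index z₀ = 0 := by
    rw [index_eq_index_of_dist_boundary_lt_of_not_mem D D' hfr hclose]
    exact D.index_eq_zero_of_mem_exterior hz₀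
  intro hcl
  rw [closure_eq_self_union_frontier] at hcl
  rcases hcl with h | h
  · exact D'.index_ne_zero_of_mem_carrier h h0
  · rw [← D'.range_boundary] at h
    obtain ⟨t, ht⟩ := h
    have h1 : infDist z₀ (frontier D.carrier) ≤ dist (D'.boundary t) (D.boundary t) := by
      rw [ht]
      exact infDist_le_dist_of_mem (D.boundary_mem_frontier t)
    exact absurd (hclose t) (not_lt.2 h1)

/-- **Closures under an `ε`-perturbation of the boundary loop**: a point of `closure D'` lies in
`closure D` or within `ε` of `∂D`. [folklore] -/
theorem mem_closure_or_infDist_le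
    (D D' : JordanDomain) {ε : ℝ} (hclose : ∀ t, dist (D'.boundary t) (D.boundary t) ≤ ε)
    {z : ℂ} (hz : z ∈ closure D'.carrier) :
    z ∈ closure D.carrier ∨ infDist z (frontier D.carrier) ≤ ε := by
  by_contra h
  simp only [not_or, not_le] at h
  exact not_mem_closure_of_dist_boundary_lt D D' h.1 (fun t => (hclose t).trans_lt h.2) hz

/-- **Interiors under an `ε`-perturbation of the boundary loop**: a point of `D` at distance
`> ε` from `∂D` lies in `D'`. [folklore] -/
theorem mem_carrier_of_lt_infDist
    (D D' : JordanDomain) {ε : ℝ} (hclose : ∀ t, dist (D'.boundary t) (D.boundary t) ≤ ε)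
    {z : ℂ} (hz : z ∈ D.carrier) (hε : ε < infDist z (frontier D.carrier)) : z ∈ D'.carrier :=
  D.mem_carrier_of_dist_boundary_lt D' hz fun t => (hclose t).trans_lt hε

/-! ### Reading an `ε`-perturbation back in the model -/

/-- **Uniform continuity of `Φ⁻¹` near a compact set**: for a compact `K` and `ε₂ > 0` there is
`ε₁ ∈ (0, 1]` such that every point within `ε₁` of `Φ q`, `q ∈ K`, is sent by `Φ⁻¹` within `ε₂`
of `q`. [folklore] -/
theorem exists_forall_dist_symm_le (Φ : ℂ ≃ₜ ℂ) {K : Set ℂ} (hK : IsCompact K)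
    {ε₂ : ℝ} (hε₂ : 0 < ε₂) :
    ∃ ε₁ > 0, ε₁ ≤ 1 ∧ ∀ q ∈ K, ∀ z, dist z (Φ q) ≤ ε₁ → dist (Φ.symm z) q ≤ ε₂ := by
  obtain ⟨r, hr⟩ := (hK.image Φ.continuous).isBounded.subset_closedBall 0
  set K₁ : Set ℂ := closedBall 0 (r + 1) with hK₁
  have hK₁c : IsCompact K₁ := isCompact_closedBall _ _
  have huc := hK₁c.uniformContinuousOn_of_continuous Φ.symm.continuous.continuousOn
  rw [Metric.uniformContinuousOn_iff] at huc
  obtain ⟨η, hη, h⟩ := huc ε₂ hε₂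
  refine ⟨min (η / 2) 1, by positivity, min_le_right _ _, fun q hq z hz => ?_⟩
  have hΦq : Φ q ∈ closedBall (0 : ℂ) r := hr (mem_image_of_mem Φ hq)
  rw [mem_closedBall] at hΦq
  have hq1 : Φ q ∈ K₁ := by
    rw [hK₁, mem_closedBall]; linarith
  have hz1 : z ∈ K₁ := by
    rw [hK₁, mem_closedBall]
    have := dist_triangle z (Φ q) 0
    have h1 : dist z (Φ q) ≤ 1 := hz.trans (min_le_right _ _)
    linarith
  have hlt : dist z (Φ q) < η := hz.trans_lt (lt_of_le_of_lt (min_le_left _ _) (by linarith))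
  have := h z hz1 (Φ q) hq1 hlt
  rw [Homeomorph.symm_apply_apply] at this
  exact this.le

/-- A bound on the imaginary part from a bound on the distance. [folklore] -/
theorem abs_im_sub_le_of_dist_le {w q : ℂ} {ε : ℝ} (h : dist w q ≤ ε) : |w.im - q.im| ≤ ε := by
  rw [Complex.dist_eq] at h
  exact (Complex.abs_im_le_norm (w - q)).trans (by simpa using h)

/-- A bound on the real part from a bound on the distance. [folklore] -/
theorem abs_re_sub_le_of_dist_le {w q : ℂ} {ε : ℝ} (h : dist w q ≤ ε) : |w.re - q.re| ≤ ε := by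
  rw [Complex.dist_eq] at h
  exact (Complex.abs_re_le_norm (w - q)).trans (by simpa using h)

/-! ### Arcs and marks of perturbed model rectangles -/

/-- The arcs of a marked domain only depend on the boundary loop and the marks: if two marked
domains have the same marks, the `i`-th arc of the first is the image under its boundary loop of
the SAME parameter interval as for the second. [folklore] -/
theorem nextMark_eq_of_mark_eq
    {n : ℕ} {P D : MarkedDomain n} (h : ∀ i, P.mark i = D.mark i) (i : Fin n) :
    P.nextMark i = D.nextMark i := by
  unfold MarkedDomain.nextMark
  split_ifs <;> simp [h]

/-- A point of the `i`-th arc of `P` is `P.boundary s` for a parameter `s` of the `i`-th parameter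
interval of any marked domain `D` with the same marks, and then `D.boundary s ∈ D.arc i`.
[folklore] -/
theorem exists_param_of_mem_arc
    {n : ℕ} {P D : MarkedDomain n} (h : ∀ i, P.mark i = D.mark i) {i : Fin n} {z : ℂ}
    (hz : z ∈ P.arc i) : ∃ s, z = P.boundary s ∧ D.boundary s ∈ D.arc i := by
  obtain ⟨s, hs, rfl⟩ := hz
  refine ⟨s, rfl, mem_image_of_mem _ ?_⟩
  rwa [← h i, ← nextMark_eq_of_mark_eq h i]

/-- The marks of a perturbed model rectangle are the quarter marks. [folklore] -/
@[simp] theorem perturbQuad_mark (Φ : ℂ ≃ₜ ℂ) {x₀ x₁ y₀ y₁ : ℝ} (hx : x₀ < x₁) (hy : y₀ < y₁)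
    (i : Fin 4) : (perturbQuad Φ x₀ x₁ y₀ y₁ hx hy).mark i = quarterMarks i := rfl

/-- The boundary loop of a perturbed model rectangle. [folklore] -/
theorem perturbQuad_boundary (Φ : ℂ ≃ₜ ℂ) {x₀ x₁ y₀ y₁ : ℝ} (hx : x₀ < x₁) (hy : y₀ < y₁)
    (s : ℝ) : (perturbQuad Φ x₀ x₁ y₀ y₁ hx hy).boundary s =
      Φ (polygonLoop (rectVerts ((x₁ - x₀) / 2) ((y₁ - y₀) / 2)) s +
        ⟨(x₀ + x₁) / 2, (y₀ + y₁) / 2⟩) := rfl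

/-- The frontier of a perturbed model rectangle is the image of the boundary of the closed
rectangle, all of whose points lie in the closed rectangle. [folklore] -/
theorem frontier_perturbQuad_subset (Φ : ℂ ≃ₜ ℂ) {x₀ x₁ y₀ y₁ : ℝ} (hx : x₀ < x₁) (hy : y₀ < y₁) :
    frontier (perturbQuad Φ x₀ x₁ y₀ y₁ hx hy).carrier ⊆ Φ '' (Icc x₀ x₁ ×ℂ Icc y₀ y₁) := by
  intro z hz
  have : z ∈ closure (perturbQuad Φ x₀ x₁ y₀ y₁ hx hy).carrier := frontier_subset_closure hz
  rwa [closure_perturbQuad_carrier] at this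

end Summit.CriticalPhenomena.CardyFormulaZ2.Theorems
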